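import Literature.NumberTheory.EllipticCurves.MordellCurvePhiDescentHom
import Literature.NumberTheory.EllipticCurves.ThreeIsogenyKernelX
import Literature.NumberTheory.EllipticCurves.FrobeniusEndomorphism
import HarnessLib

/-!
# Over a finite field the `φ`-descent map of `Y² = X³ + 81c²` is onto `k*/k*³`

Topic `NumberTheory/EllipticCurves`. Fifth file of the programme towards
`Literature.Barriers.BirchSwinnertonDyer.Cassels1964_sha_threeRank_jZero` (Cassels 1964,
*Arithmetic on curves of genus 1, VI*; see
`Literature/Barriers/BirchSwinnertonDyer/DescentDefectUnboundedCasselsProofs.lean`): the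
residue-field input of the local solubility of Cassels' torsors at the good primes `p ≡ 1 (mod 3)`
(p. 66: "the only `p`-adic fields in which there might not be points on (2) are the `3`-adic field
and the `q`-adic fields with `q | d`"). Everything here is proved; no named facts and no
definitions.

* `isVeluThreePair_mordell_of_sq`: over any field `F` with `θ² = −3` and `2, 3, c ≠ 0`,
  `(E_{−3c²}, E_{81c²})` is the Vélu three-pair of `ThreeIsogeny` with parameters `(0, cθ)`, so the
  `3`-isogeny `φ` with kernel `{O, (0, ±cθ)}` acts on `F`-points (`IsVeluThreePair.pointHom`).
* `cubeUnits_cases`: over a finite field `k`, every class of `k*/k*³` is `1`, `[g]` or `[g]²` for a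
  generator `g` of `k*`.
* **`exists_cubicDescent_eq_of_finite`**: over a finite field `k` with `2, 3 ≠ 0`, `√−3 ∈ k` and
  `c ≠ 0`, every `u ∈ k*` is `δ(P') w³` for some `P' ∈ E'(k) = E_{81c²}(k)` and `w ∈ k*`, where
  `δ = MordellDescent.cubicDescent (9c)` (`O ↦ 1`, `−T' ↦ (18c)²`, `(X, Y) ↦ Y + 9c`) is the
  `φ`-descent map of `MordellCurvePhiDescentHom`. Proof: `#E(k) = #E'(k)`
  (`WeierstrassCurve.natCard_point_kernelXThree_eq`, file `ThreeIsogenyKernelX`: isogenous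
  curves over a finite field have equally many points); `ker φ|_{E(k)} = {O, ±T}` has order `3`
  (`T = (0, c√−3)` is rational), so `#φ(E(k)) = #E'(k)/3`; each fibre of `δ` embeds into
  `ker δ ⊆ φ(E(k))` by `P ↦ P − P₀` (`cubicDescentClass_sub_eq_one`,
  `exists_pointFun_eq_of_cubicDescentClass_eq_one`), so has at most `#E'(k)/3` elements; and
  `k*/k*³` has at most three classes — if one were missed, `#E'(k) ≤ 2 #E'(k)/3`, contradicting
  `#E'(k) ≥ 1`. (This replaces the character-sum estimate one would otherwise need; it is the
  finite-field shadow of "the image of the local descent map at a good prime is the unit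
  classes".)

## References

* [Cassels1964ArithmeticVI] J. W. S. Cassels, J. reine angew. Math. 214/215 (1964) 65–70, p. 66.
* [SilvermanAEC2009] J. H. Silverman, *The Arithmetic of Elliptic Curves*, 2nd ed., GTM 106,
  Exercise 5.4(a) (isogenous curves over finite fields), X.§4 (local images of descent maps).
-/

noncomputable section

open scoped Classical

open WeierstrassCurve

universe u

namespace Literature.NumberTheory.EllipticCurves

namespace MordellDescent

/-! ## The local Vélu pair over a field containing `√−3` -/

section VeluOfTheta

variable {F : Type u} [Field F] {c θ : F}

/-- **`(E_{−3c²}, E_{81c²})` is the Vélu three-pair with parameters `(0, cθ)`** over any field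
containing `θ = √−3` with `2, 3, c ≠ 0` (`a₆ = (cθ)² = −3c²`, `a₆' = −27(cθ)² = 81c²`,
`Δ = −3888 c⁴ = −2⁴3⁵c⁴ ≠ 0`). [folklore] -/
theorem isVeluThreePair_mordell_of_sq (hθ : θ ^ 2 = -3) (h2 : (2 : F) ≠ 0) (h3 : (3 : F) ≠ 0)
    (hc : c ≠ 0) :
    IsVeluThreePair (0 : F) (c * θ) (mordellCurve (-3 * c ^ 2)) (mordellCurve (81 * c ^ 2)) where
  a₁_eq := rfl
  a₂_eq := by rw [mordellCurve_a₂]; ring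
  a₃_eq := rfl
  a₄_eq := by rw [mordellCurve_a₄]; ring
  a₆_eq := by rw [mordellCurve_a₆, mul_pow, hθ]; ring
  a₁'_eq := rfl
  a₂'_eq := by rw [mordellCurve_a₂]; ring
  a₃'_eq := rfl
  a₄'_eq := by rw [mordellCurve_a₄]; ring
  a₆'_eq := by rw [mordellCurve_a₆, mul_pow, hθ]; ring
  Δ_ne := by
    rw [mordellCurve_Δ, neg_ne_zero, show (432 : F) * (-3 * c ^ 2) ^ 2 = (2 ^ 4 * 3 ^ 5) * c ^ 4 by ring]
    exact mul_ne_zero (mul_ne_zero (pow_ne_zero 4 h2) (pow_ne_zero 5 h3)) (pow_ne_zero 4 hc)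

end VeluOfTheta

/-! ## Over a finite field: the `φ`-descent map is onto `k*/k*³` -/

section FiniteField

variable {k : Type u} [Field k] [Finite k] {c θ : k}

/-- Over a finite field every class of `k*/k*³` is `1`, `[g]` or `[g]²` for a generator `g` of
`k*` (so there are at most three classes). [folklore] -/
theorem cubeUnits_cases : ∃ g : kˣ, ∀ γ : CubeUnits k,
    γ = 1 ∨ γ = QuotientGroup.mk g ∨ γ = QuotientGroup.mk g * QuotientGroup.mk g := by
  obtain ⟨g, hg⟩ := IsCyclic.exists_generator (α := kˣ)
  refine ⟨g, fun γ => ?_⟩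
  obtain ⟨u, rfl⟩ := QuotientGroup.mk_surjective γ
  obtain ⟨n, rfl⟩ := Subgroup.mem_zpowers_iff.mp (hg u)
  have h3 : (QuotientGroup.mk g : CubeUnits k) ^ (3 : ℕ) = 1 := by
    rw [pow_succ, pow_two]; exact CubeUnits.mul_mul_self _
  rw [QuotientGroup.mk_zpow, zpow_eq_zpow_emod' n h3, show ((3 : ℕ) : ℤ) = 3 from rfl]
  have hn : n % 3 = 0 ∨ n % 3 = 1 ∨ n % 3 = 2 := by omega
  rcases hn with h | h | h <;> rw [h]
  · exact Or.inl (zpow_zero _)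
  · exact Or.inr (Or.inl (zpow_one _))
  · exact Or.inr (Or.inr (zpow_two _))

/-- **Over a finite field `k` with `6 ≠ 0` and `√−3 ∈ k`, the `φ`-descent map
`δ : E'_{9c}(k) → k*/k*³` is onto**: every `u ∈ k*` is `δ(P') w³` for some `P' ∈ E'(k)`, `w ∈ k*`
(`E' : Y² = X³ + 81c²`, `δ = cubicDescent (9c)`: `O ↦ 1`, `−T' ↦ (18c)²`, `(X, Y) ↦ Y + 9c`).
Proof: `#E(k) = #E'(k)` for the `3`-isogenous `E : y² = x³ − 3c²`
(`natCard_point_kernelXThree_eq`, isogenous curves over a finite field have equally many points);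
`φ : E(k) → E'(k)` has kernel `{O, ±T}` of order `3` (`T = (0, c√−3)` is rational), so
`#φ(E(k)) = #E'(k)/3`; the fibres of `δ` are translates of subsets of `ker δ ⊆ φ(E(k))`
(`cubicDescentClass_sub_eq_one`, `exists_pointFun_eq_of_cubicDescentClass_eq_one`), hence have
at most `#E'(k)/3` elements; and `k*/k*³` has at most `3` classes — so no class can be missed.
This is the surjectivity of the local descent map at the good primes `p ≡ 1 (mod 3)` (image = all
units), read on the residue field. [cite: Cassels1964ArithmeticVI, p. 66] -/
theorem exists_cubicDescent_eq_of_finite (hθ : θ ^ 2 = -3) (h2 : (2 : k) ≠ 0) (h3 : (3 : k) ≠ 0)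
    (hc : c ≠ 0) {u : k} (hu : u ≠ 0) :
    ∃ (P : (mordellCurve (81 * c ^ 2)).toAffine.Point) (w : k), w ≠ 0 ∧
      cubicDescent (mordellCurve (81 * c ^ 2)) (9 * c) P = u * w ^ 3 := by
  classical
  have hV := isVeluThreePair_mordell_of_sq hθ h2 h3 hc
  have h9c : (9 : k) * c ≠ 0 :=
    mul_ne_zero (by rw [show (9 : k) = 3 * 3 by norm_num]; exact mul_ne_zero h3 h3) hc
  have h2B : (2 : k) * (9 * c) ≠ 0 := mul_ne_zero h2 h9c
  have hW' : mordellCurve (81 * c ^ 2) = mordellCurve ((9 * c) ^ 2) := by congr 1; ring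
  haveI : Finite (mordellCurve (-3 * c ^ 2)).toAffine.Point := WeierstrassCurve.finite_point _
  haveI : Finite (mordellCurve (81 * c ^ 2)).toAffine.Point := WeierstrassCurve.finite_point _
  letI : Fintype (mordellCurve (-3 * c ^ 2)).toAffine.Point := Fintype.ofFinite _
  letI : Fintype (mordellCurve (81 * c ^ 2)).toAffine.Point := Fintype.ofFinite _
  -- `#E(k) = #E'(k)`
  have hN : Nat.card (mordellCurve (-3 * c ^ 2)).toAffine.Point =
      Nat.card (mordellCurve (81 * c ^ 2)).toAffine.Point := by
    have h := natCard_point_kernelXThree_eq (0 : k) 0 (-3 * c ^ 2) (by ring) hV.Δ_ne h3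
    have e : (⟨0, 0, 0, -9 * 0, -(27 * (-3 * c ^ 2) + 8 * 0 * 0)⟩ : WeierstrassCurve k) = mordellCurve (81 * c ^ 2) := by
      simp only [mordellCurve]; congr 1 <;> ring
    rw [e] at h
    exact h
  have hN0 := natCard_point_ne_zero (mordellCurve (81 * c ^ 2))
  -- the kernel of `φ` on `k`-points has `3` elements
  set φk := hV.pointHom with hφk
  have hker : Nat.card φk.ker = 3 := by
    have hT0 := hV.T_ne_zero
    have hTT := hV.T_ne_neg_T
    have hset : (φk.ker : Set (mordellCurve (-3 * c ^ 2)).toAffine.Point) = {0, hV.T, -hV.T} := by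
      ext P
      rw [SetLike.mem_coe, AddMonoidHom.mem_ker, hφk, hV.pointHom_apply, hV.pointFun_eq_zero_iff]
      simp only [Set.mem_insert_iff, Set.mem_singleton_iff]
    rw [← SetLike.coe_sort_coe, hset, Nat.card_coe_set_eq, Set.ncard_insert_of_notMem, Set.ncard_pair hTT]
    simp only [Set.mem_insert_iff, Set.mem_singleton_iff, not_or]
    exact ⟨hT0.symm, fun h => hT0 (neg_eq_zero.mp h.symm)⟩
  -- so `#φ(E(k)) · 3 = #E(k)`
  have hrange : Nat.card φk.range * 3 = Nat.card (mordellCurve (-3 * c ^ 2)).toAffine.Point := by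
    rw [← hker, AddSubgroup.card_eq_card_quotient_mul_card_addSubgroup φk.ker,
      Nat.card_congr (QuotientAddGroup.quotientKerEquivRange φk).toEquiv]
  -- the descent classes and the bound on their fibres
  set f : (mordellCurve (81 * c ^ 2)).toAffine.Point → CubeUnits k :=
    fun P => cubicDescentClass (mordellCurve (81 * c ^ 2)) (9 * c) P with hf
  have hrangeF : Nat.card φk.range =
      ((Finset.univ : Finset (mordellCurve (81 * c ^ 2)).toAffine.Point).filter fun Q => Q ∈ φk.range).card := by
    rw [Nat.card_eq_fintype_card, Fintype.card_subtype]
  have hfib : ∀ γ : CubeUnits k,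
      ((Finset.univ : Finset (mordellCurve (81 * c ^ 2)).toAffine.Point).filter fun P => f P = γ).card ≤
        Nat.card φk.range := by
    intro γ
    rcases ((Finset.univ : Finset (mordellCurve (81 * c ^ 2)).toAffine.Point).filter
        fun P => f P = γ).eq_empty_or_nonempty with he | ⟨P₀, hP₀⟩
    · rw [he, Finset.card_empty]; exact Nat.zero_le _
    rw [Finset.mem_filter] at hP₀
    rw [hrangeF]
    refine Finset.card_le_card_of_injOn (fun P => P - P₀) (fun P hP => ?_)
      (fun P _ Q _ h => sub_left_injective h)
    rw [Finset.coe_filter, Set.mem_setOf_eq] at hP ⊢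
    refine ⟨Finset.mem_univ _, ?_⟩
    obtain ⟨Q, hQ⟩ := exists_pointFun_eq_of_cubicDescentClass_eq_one hV hθ h2 h3 hc (P - P₀)
      (cubicDescentClass_sub_eq_one hW' h2 h9c (hP.2.trans hP₀.2.symm))
    exact ⟨Q, hQ⟩
  -- suppose the class of `u` is missed
  by_contra hno
  have hmiss : ∀ P, f P ≠ cubeClass u := fun P h => by
    obtain ⟨w, hw, e⟩ := (cubeClass_eq_cubeClass_iff (cubicDescent_ne_zero h2B P) hu).mp h
    exact hno ⟨P, w, hw, e⟩
  obtain ⟨g, hg⟩ := cubeUnits_cases (k := k)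
  -- then all classes of points lie in the two remaining classes
  obtain ⟨γ₁, γ₂, hγ⟩ : ∃ γ₁ γ₂ : CubeUnits k, ∀ P, f P = γ₁ ∨ f P = γ₂ := by
    rcases hg (cubeClass u) with h0 | h0 | h0
    · refine ⟨QuotientGroup.mk g, QuotientGroup.mk g * QuotientGroup.mk g, fun P => ?_⟩
      rcases hg (f P) with h | h | h
      · exact absurd (h.trans h0.symm) (hmiss P)
      · exact Or.inl h
      · exact Or.inr h
    · refine ⟨1, QuotientGroup.mk g * QuotientGroup.mk g, fun P => ?_⟩
      rcases hg (f P) with h | h | h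
      · exact Or.inl h
      · exact absurd (h.trans h0.symm) (hmiss P)
      · exact Or.inr h
    · refine ⟨1, QuotientGroup.mk g, fun P => ?_⟩
      rcases hg (f P) with h | h | h
      · exact Or.inl h
      · exact Or.inr h
      · exact absurd (h.trans h0.symm) (hmiss P)
  -- count: `#E'(k) ≤ 2 · #E'(k)/3`
  have hcover : (Finset.univ : Finset (mordellCurve (81 * c ^ 2)).toAffine.Point) ⊆
      (Finset.univ.filter fun P => f P = γ₁) ∪ (Finset.univ.filter fun P => f P = γ₂) := by
    intro P _
    rw [Finset.mem_union, Finset.mem_filter, Finset.mem_filter]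
    rcases hγ P with h | h
    · exact Or.inl ⟨Finset.mem_univ _, h⟩
    · exact Or.inr ⟨Finset.mem_univ _, h⟩
  have hle : Fintype.card (mordellCurve (81 * c ^ 2)).toAffine.Point ≤ 2 * Nat.card φk.range :=
    calc Fintype.card (mordellCurve (81 * c ^ 2)).toAffine.Point
        = (Finset.univ : Finset (mordellCurve (81 * c ^ 2)).toAffine.Point).card := Finset.card_univ.symm
      _ ≤ ((Finset.univ.filter fun P => f P = γ₁) ∪ (Finset.univ.filter fun P => f P = γ₂)).card :=
          Finset.card_le_card hcover
      _ ≤ (Finset.univ.filter fun P => f P = γ₁).card + (Finset.univ.filter fun P => f P = γ₂).card :=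
          Finset.card_union_le _ _
      _ ≤ Nat.card φk.range + Nat.card φk.range := add_le_add (hfib γ₁) (hfib γ₂)
      _ = 2 * Nat.card φk.range := (two_mul _).symm
  have hN' : Fintype.card (mordellCurve (81 * c ^ 2)).toAffine.Point = Nat.card φk.range * 3 := by
    rw [← Nat.card_eq_fintype_card, ← hN, ← hrange]
  have hr : Nat.card φk.range = 0 := by omega
  apply hN0
  rw [Nat.card_eq_fintype_card, hN', hr, zero_mul]

end FiniteField


end MordellDescent

end Literature.NumberTheory.EllipticCurves

end
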